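import Summits.QuantumFields.YangMills.Theorems.ColdStartUniversalityLatticeLangevinLezaudMeasurableTools
import Summits.QuantumFields.YangMills.Theorems.EquipartitionCriticalityEquipartitionPinsProbeTangentSteinPrelim
import HarnessLib

/-!
# Route `ColdStartUniversality` (fixed-cut-off SZZ dynamics, sampler statistics): ★★★ LEZAUD'S EXPONENTIAL-MOMENT BOUND FOR TIME INTEGRALS OF
# ALL BOUNDED MEASURABLE OBSERVABLES, volume-free after the `O(log L)` burn-in, `|β'| < 1/12` (jointly measurable solutions)

Helper file (seat `ym-line-csu-p1`, g37; `--supports stmt-QuantumFields-24809`).  SU(2) lattice Langevin dynamics of Shen–Zhu–Zhu at `(L, β')`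
with `|β'| < 1/12` (`λ = 1 − 12|β'|`), Wilson measure `μ = μ_{β'}`, burn-in `a = 2 + t₀ + u`, `log B ≤ 2λt₀`.  `…LezaudBernstein` gives
`E exp(θ(∫_{(0,T]} G(U_{a+r})dr − TμG)) ≤ e·exp(Tθ²σ²/(λ − θb))` for bounded CONTINUOUS `G`; here continuity is removed for JOINTLY MEASURABLE
solutions (every space carries one: g33's regular flow), with `|G| ≤ 1` and `b = 2`:

* ★★★ `coldStart_integral_exp_timeIntegral_le_uniform_of_measurable` — for EVERY measurable `G` with `|G| ≤ 1` and `Var_{μ_{β'}}(G) ≤ σ²`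
  (`σ > 0`), every `0 ≤ θ` with `2θ < λ`, every jointly measurable strong solution from a deterministic start, all admissible `t₀, u`, `T > 0`:
  `E exp(θ(∫_{(0,T]} G(U_{2+t₀+u+r})dr − T·μ_{β'}G)) ≤ e · exp(T·θ²σ²/(λ − 2θ))`  (and the functional is integrable).

Proof: continuous `g_j` with `|g_j| ≤ 1`, `δ_j = ‖G − g_j‖_{L¹(μ)} = 1/(j+1)` (`exists_continuous_abs_le_one_integral_abs_sub_le`); the continuous
bound for `g_j` with `σ_j² = σ² + 4δ_j ≥ Var(g_j)`; `E|Y − Y_j| ≤ T(e√(2δ_j) + δ_j)` by Fubini + the warm start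
(`coldStart_integral_abs_timeIntegral_le_uniform`); `|E e^{θY} − E e^{θY_j}| ≤ θe^{2θT}E|Y − Y_j|`; `j → ∞`.
[cite: Lezaud2001, Theorem 1.1 and Remark 1.2].  THEOREMS ONLY, no definition, no sorry.  HONEST FRAMING: RECORD-rung R3 plumbing at FIXED cut-off
in LATTICE units; "volume-free" refers to `L` at fixed `|β'| < 1/12`; the route's scaling leaves the window; `UniformColdStartMixing` (24809) is
NOT restated; nothing K-uniform is proved; no crux, rung or summit statement is proved; the Yang–Mills mass gap is NOT proved.
-/

set_option autoImplicit false

noncomputable section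

namespace Summit.QuantumFields.YangMills.Theorems.ColdStartUniversality

open MeasureTheory ProbabilityTheory Filter Set Topology
open scoped BigOperators NNReal ENNReal
open Literature.Probability.Process Literature.MathematicalPhysics.QuantumFieldTheory
open Literature.MathematicalPhysics.QuantumLattice (fundamentalRep fundamentalLatticeRep continuous_fundamentalRep)

variable {L : ℕ} [NeZero L]

/-- Variances of `[-1,1]`-valued observables are `4‖G − g‖_{L¹}`-close: `Var_μ(g) ≤ Var_μ(G) + 4∫|G − g| dμ`. [folklore] -/
theorem variance_le_variance_add_of_abs_le_one {X : Type*} [MeasurableSpace X] (μ : Measure X) [IsProbabilityMeasure μ]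
    {G g : X → ℝ} (hG : Measurable G) (hG1 : ∀ x, |G x| ≤ 1) (hg : Measurable g) (hg1 : ∀ x, |g x| ≤ 1) :
    ∫ x, (g x - ∫ y, g y ∂μ) ^ 2 ∂μ ≤ (∫ x, (G x - ∫ y, G y ∂μ) ^ 2 ∂μ) + 4 * ∫ x, |G x - g x| ∂μ := by
  have iG : Integrable G μ := FeynmanKac.integrable_of_measurable_of_abs_le _ hG hG1
  have ig : Integrable g μ := FeynmanKac.integrable_of_measurable_of_abs_le _ hg hg1
  have iG2 : Integrable (fun x => G x ^ 2) μ := FeynmanKac.integrable_of_measurable_of_abs_le _ (hG.pow_const 2) (B := 1) fun x => by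
    rw [abs_pow]; nlinarith [abs_nonneg (G x), hG1 x]
  have ig2 : Integrable (fun x => g x ^ 2) μ := FeynmanKac.integrable_of_measurable_of_abs_le _ (hg.pow_const 2) (B := 1) fun x => by
    rw [abs_pow]; nlinarith [abs_nonneg (g x), hg1 x]
  have idiff : Integrable (fun x => |G x - g x|) μ := (iG.sub ig).abs
  have hvar : ∀ {f : X → ℝ}, Integrable f μ → Integrable (fun x => f x ^ 2) μ →
      ∫ x, (f x - ∫ y, f y ∂μ) ^ 2 ∂μ = (∫ x, f x ^ 2 ∂μ) - (∫ y, f y ∂μ) ^ 2 := by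
    intro f hf hf2
    have hfun : (fun x => (f x - ∫ y, f y ∂μ) ^ 2) = fun x => (f x ^ 2 - (2 * ∫ y, f y ∂μ) * f x) + (∫ y, f y ∂μ) ^ 2 := by
      funext x; ring
    have i12 : Integrable (fun x => f x ^ 2 - (2 * ∫ y, f y ∂μ) * f x) μ := hf2.sub (hf.const_mul _)
    rw [hfun, integral_add i12 (integrable_const _), integral_sub hf2 (hf.const_mul _), integral_const_mul, integral_const, probReal_univ,
      one_smul]
    ring
  rw [hvar ig ig2, hvar iG iG2]
  have hmG : |∫ y, G y ∂μ| ≤ 1 := abs_integral_le_of_abs_le_of_isProbabilityMeasure hG1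
  have hmg : |∫ y, g y ∂μ| ≤ 1 := abs_integral_le_of_abs_le_of_isProbabilityMeasure hg1
  have hmm : |(∫ y, G y ∂μ) - ∫ y, g y ∂μ| ≤ ∫ x, |G x - g x| ∂μ := by
    rw [← integral_sub iG ig]; exact abs_integral_le_integral_abs
  have hsq : |(∫ x, g x ^ 2 ∂μ) - ∫ x, G x ^ 2 ∂μ| ≤ 2 * ∫ x, |G x - g x| ∂μ := by
    rw [← integral_sub ig2 iG2, ← integral_const_mul]
    refine abs_integral_le_integral_abs.trans (integral_mono (ig2.sub iG2).abs (idiff.const_mul 2) fun x => ?_)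
    rw [show g x ^ 2 - G x ^ 2 = (g x + G x) * (g x - G x) by ring, abs_mul, abs_sub_comm (g x) (G x)]
    exact mul_le_mul_of_nonneg_right ((abs_add_le _ _).trans (by linarith [hg1 x, hG1 x])) (abs_nonneg _)
  have hmsq : |(∫ y, g y ∂μ) ^ 2 - (∫ y, G y ∂μ) ^ 2| ≤ 2 * ∫ x, |G x - g x| ∂μ := by
    rw [show (∫ y, g y ∂μ) ^ 2 - (∫ y, G y ∂μ) ^ 2 = ((∫ y, g y ∂μ) + ∫ y, G y ∂μ) * ((∫ y, g y ∂μ) - ∫ y, G y ∂μ) by ring, abs_mul,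
      abs_sub_comm (∫ y, g y ∂μ)]
    have := mul_le_mul ((abs_add_le _ _).trans (add_le_add hmg hmG)) hmm (abs_nonneg _) (by norm_num)
    linarith
  linarith [(abs_le.1 hsq).2, (abs_le.1 hmsq).1]

/-- ★★★ **LEZAUD'S EXPONENTIAL MOMENT BOUND FOR TIME INTEGRALS OF ALL BOUNDED MEASURABLE OBSERVABLES (jointly measurable solutions),
`|β'| < 1/12`, VOLUME-FREE after the `O(log L)` burn-in.**  For every `L`, `|β'| < 1/12` (`λ := 1 − 12|β'|`), every deterministic start `z`,
every JOINTLY MEASURABLE strong solution `U` from `z` on any filtered probability space, EVERY measurable `G` with `|G| ≤ 1` and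
`Var_{μ_{β'}}(G) ≤ σ²`, every `0 ≤ θ` with `2θ < λ`, all `t₀, u` with `log B ≤ 2λt₀` and every `T > 0`: the functional
`exp(θ(∫_{(0,T]} G(U_{2+t₀+u+r}) dr − T·μ_{β'}G))` is integrable and

  `∫ exp(θ · (∫_{(0,T]} G(U_{2+t₀+u+r}) dr − T·μ_{β'}G)) dP ≤ e · exp(T · θ²σ²/(λ − 2θ))`.

[cite: Lezaud2001, Theorem 1.1 and Remark 1.2] -/
theorem coldStart_integral_exp_timeIntegral_le_uniform_of_measurable (L : ℕ) [NeZero L] (β' : ℝ) (hβ : |β'| < 1 / 12)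
    (z : GaugeConfig 3 L (Matrix.specialUnitaryGroup (Fin 2) ℂ))
    {Ω : Type} [MeasurableSpace Ω] {P : Measure Ω} [IsProbabilityMeasure P]
    {W : ℝ≥0 → Ω → (Edge 3 L × NoiseIdx 2 → ℝ)} (hW : IsFlatBrownian W P)
    {U : ℝ≥0 → Ω → GaugeConfig 3 L (Matrix.specialUnitaryGroup (Fin 2) ℂ)} (hU0 : ∀ ω, U 0 ω = z)
    (hU : (latticeLangevinDynamics (fundamentalLatticeRep 2) β').IsSolution (fundamentalRep (Fin 2)) hW.natFiltration P W U)
    (hUj : Measurable (Function.uncurry U))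
    {G : GaugeConfig 3 L (Matrix.specialUnitaryGroup (Fin 2) ℂ) → ℝ} (hG : Measurable G) (hG1 : ∀ x, |G x| ≤ 1) {σ : ℝ}
    (hσ2 : ∫ x, (G x - ∫ y, G y ∂(wilsonMeasure (d := 3) (L := L) (fundamentalRep (Fin 2)) β')) ^ 2 ∂(wilsonMeasure (d := 3) (L := L) (fundamentalRep (Fin 2)) β') ≤ σ ^ 2)
    {θ : ℝ} (hθ : 0 ≤ θ) (hθ2 : θ * 2 < 1 - 12 * |β'|) (t₀ u : ℝ≥0)
    (ht₀ : Real.log (96 * |β'| * (Fintype.card (Edge 3 L) : ℝ) + 10 * |β'| * (Fintype.card (Plaquette 3 L) : ℝ) + Real.log 2 +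
      (Fintype.card (Edge 3 L) : ℝ) * Real.log (3 / 2)) ≤ 2 * (1 - 12 * |β'|) * t₀)
    {T : ℝ} (hT : 0 < T) :
    Integrable (fun ω => Real.exp (θ * ((∫ r in Ioc 0 T, G (U (2 + t₀ + u + r.toNNReal) ω)) - T * ∫ y, G y ∂(wilsonMeasure (d := 3) (L := L) (fundamentalRep (Fin 2)) β')))) P ∧
    ∫ ω, Real.exp (θ * ((∫ r in Ioc 0 T, G (U (2 + t₀ + u + r.toNNReal) ω)) - T * ∫ y, G y ∂(wilsonMeasure (d := 3) (L := L) (fundamentalRep (Fin 2)) β'))) ∂P ≤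
      Real.exp 1 * Real.exp (T * (θ ^ 2 * σ ^ 2 / ((1 - 12 * |β'|) - θ * 2))) := by
  classical
  haveI := secondCountableTopology_su2
  haveI := borelSpace_config L
  haveI : IsProbabilityMeasure (wilsonMeasure (d := 3) (L := L) (fundamentalRep (Fin 2)) β') :=
    isProbabilityMeasure_wilsonMeasure (d := 3) (L := L) (fundamentalRep (Fin 2)) (continuous_fundamentalRep (Fin 2)) β'
  haveI : IsFiniteMeasure (volume.restrict (Ioc (0 : ℝ) T)) := isFiniteMeasure_restrict.2 measure_Ioc_lt_top.ne
  set lam : ℝ := 1 - 12 * |β'| with hlamdef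
  have hlam : 0 < lam := by rw [hlamdef]; linarith
  set m : ℝ := ∫ y, G y ∂(wilsonMeasure (d := 3) (L := L) (fundamentalRep (Fin 2)) β') with hm
  have hm1 : |m| ≤ 1 := abs_integral_le_of_abs_le_of_isProbabilityMeasure hG1
  -- time integrals of bounded measurable observables along the jointly measurable solution
  have hjoint : Measurable fun p : Ω × ℝ => U (2 + t₀ + u + p.2.toNNReal) p.1 :=
    hUj.comp (((measurable_real_toNNReal.comp measurable_snd).const_add (2 + t₀ + u)).prodMk measurable_fst)
  have hsec : ∀ ω : Ω, Measurable fun r : ℝ => U (2 + t₀ + u + r.toNNReal) ω := fun ω =>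
    hUj.comp ((measurable_real_toNNReal.const_add (2 + t₀ + u)).prodMk measurable_const)
  have hTI : ∀ {φ : GaugeConfig 3 L (Matrix.specialUnitaryGroup (Fin 2) ℂ) → ℝ}, Measurable φ → ∀ {B : ℝ}, (∀ x, |φ x| ≤ B) →
      Measurable (fun ω => ∫ r in Ioc 0 T, φ (U (2 + t₀ + u + r.toNNReal) ω)) ∧
        ∀ ω, |∫ r in Ioc 0 T, φ (U (2 + t₀ + u + r.toNNReal) ω)| ≤ B * T := by
    intro φ hφ B hB
    refine ⟨((hφ.comp hjoint).stronglyMeasurable.integral_prod_right' (ν := volume.restrict (Ioc (0 : ℝ) T))).measurable, fun ω => ?_⟩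
    have h := norm_setIntegral_le_of_norm_le_const (μ := volume) (s := Ioc (0 : ℝ) T) measure_Ioc_lt_top
      (f := fun r : ℝ => φ (U (2 + t₀ + u + r.toNNReal) ω)) (C := B) fun r _ => by rw [Real.norm_eq_abs]; exact hB _
    rwa [Real.norm_eq_abs, Real.volume_real_Ioc_of_le hT.le, sub_zero] at h
  -- the approximants
  set δ : ℕ → ℝ := fun j => 1 / ((j : ℝ) + 1) with hδdef
  have hδ0 : ∀ j, 0 < δ j := fun j => by rw [hδdef]; positivity
  have hδlim : Tendsto δ atTop (𝓝 0) := tendsto_one_div_add_atTop_nhds_zero_nat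
  have happrox : ∀ j : ℕ, ∃ g : GaugeConfig 3 L (Matrix.specialUnitaryGroup (Fin 2) ℂ) → ℝ, Continuous g ∧ (∀ x, |g x| ≤ 1) ∧
      ∫ x, |G x - g x| ∂(wilsonMeasure (d := 3) (L := L) (fundamentalRep (Fin 2)) β') ≤ δ j := fun j => exists_continuous_abs_le_one_integral_abs_sub_le L β' hG hG1 (hδ0 j)
  choose g hgc hg1 hgL1 using happrox
  have hgm : ∀ j, Measurable (g j) := fun j => (hgc j).measurable
  set mg : ℕ → ℝ := fun j => ∫ y, g j y ∂(wilsonMeasure (d := 3) (L := L) (fundamentalRep (Fin 2)) β') with hmg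
  have iG : Integrable G (wilsonMeasure (d := 3) (L := L) (fundamentalRep (Fin 2)) β') := FeynmanKac.integrable_of_measurable_of_abs_le _ hG hG1
  have ig : ∀ j, Integrable (g j) (wilsonMeasure (d := 3) (L := L) (fundamentalRep (Fin 2)) β') := fun j => FeynmanKac.integrable_of_measurable_of_abs_le _ (hgm j) (hg1 j)
  have hdiff : ∀ j, Measurable fun x => G x - g j x := fun j => hG.sub (hgm j)
  have hdiffb : ∀ j x, |G x - g j x| ≤ 2 := fun j x => (abs_sub _ _).trans (by linarith [hG1 x, hg1 j x])
  have hmm : ∀ j, |m - mg j| ≤ δ j := fun j => by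
    rw [hm, hmg, ← integral_sub iG (ig j)]; exact abs_integral_le_integral_abs.trans (hgL1 j)
  have hL2 : ∀ j, (∫ x, (G x - g j x) ^ 2 ∂(wilsonMeasure (d := 3) (L := L) (fundamentalRep (Fin 2)) β')) ^ (1 / (2 : ℝ)) ≤ Real.sqrt (2 * δ j) := fun j => by
    rw [← Real.sqrt_eq_rpow]
    refine Real.sqrt_le_sqrt ?_
    have hpt : ∀ x, (G x - g j x) ^ 2 ≤ 2 * |G x - g j x| := fun x => by
      rw [← sq_abs]; nlinarith [abs_nonneg (G x - g j x), hdiffb j x]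
    calc ∫ x, (G x - g j x) ^ 2 ∂(wilsonMeasure (d := 3) (L := L) (fundamentalRep (Fin 2)) β') ≤ ∫ x, 2 * |G x - g j x| ∂(wilsonMeasure (d := 3) (L := L) (fundamentalRep (Fin 2)) β') :=
          integral_mono (FeynmanKac.integrable_of_measurable_of_abs_le _ ((hdiff j).pow_const 2) (B := 4) fun x => by
            rw [abs_pow]; nlinarith [abs_nonneg (G x - g j x), hdiffb j x]) ((iG.sub (ig j)).abs.const_mul 2) hpt
      _ ≤ 2 * δ j := by rw [integral_const_mul]; linarith [hgL1 j]
  have hvar : ∀ j, ∫ x, (g j x - mg j) ^ 2 ∂(wilsonMeasure (d := 3) (L := L) (fundamentalRep (Fin 2)) β') ≤ Real.sqrt (σ ^ 2 + 4 * δ j) ^ 2 := fun j => by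
    rw [Real.sq_sqrt (by nlinarith [hδ0 j]), hmg]
    linarith [variance_le_variance_add_of_abs_le_one (wilsonMeasure (d := 3) (L := L) (fundamentalRep (Fin 2)) β') hG hG1 (hgm j) (hg1 j), hgL1 j]
  -- the functionals `Y`, `Y_j`
  set Y : Ω → ℝ := fun ω => (∫ r in Ioc 0 T, G (U (2 + t₀ + u + r.toNNReal) ω)) - T * m with hYdef
  set Yg : ℕ → Ω → ℝ := fun j ω => (∫ r in Ioc 0 T, g j (U (2 + t₀ + u + r.toNNReal) ω)) - T * mg j with hYgdef
  obtain ⟨hIGm, hIGb⟩ := hTI hG hG1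
  have hYm : Measurable Y := hIGm.sub measurable_const
  have hYb : ∀ ω, |Y ω| ≤ 2 * T := fun ω => by
    have h2 : |T * m| ≤ T := by rw [abs_mul, abs_of_pos hT]; nlinarith
    exact (abs_sub _ _).trans (by linarith [hIGb ω])
  have hYgm : ∀ j, Measurable (Yg j) := fun j => (hTI (hgm j) (hg1 j)).1.sub measurable_const
  have hYgb : ∀ j ω, |Yg j ω| ≤ 2 * T := fun j ω => by
    have hmg1 : |mg j| ≤ 1 := abs_integral_le_of_abs_le_of_isProbabilityMeasure (hg1 j)
    have h2 : |T * mg j| ≤ T := by rw [abs_mul, abs_of_pos hT]; nlinarith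
    exact (abs_sub _ _).trans (by linarith [(hTI (hgm j) (hg1 j)).2 ω])
  -- `E|Y − Y_j| ≤ T (e √(2δ_j) + δ_j)`
  have hEdiff : ∀ j, ∫ ω, |Y ω - Yg j ω| ∂P ≤ T * (Real.exp 1 * Real.sqrt (2 * δ j) + δ j) := by
    intro j
    obtain ⟨hDm, hDb⟩ := hTI (hdiff j) (hdiffb j)
    have hDi : Integrable (fun ω => |∫ r in Ioc 0 T, (G (U (2 + t₀ + u + r.toNNReal) ω) - g j (U (2 + t₀ + u + r.toNNReal) ω))|) P :=
      FeynmanKac.integrable_of_measurable_of_abs_le _ hDm.abs fun ω => by rw [abs_abs]; exact hDb ω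
    have hsplit : ∀ ω, Y ω - Yg j ω =
        (∫ r in Ioc 0 T, (G (U (2 + t₀ + u + r.toNNReal) ω) - g j (U (2 + t₀ + u + r.toNNReal) ω))) - T * (m - mg j) := by
      intro ω
      rw [hYdef, hYgdef]; dsimp only
      have i1 : Integrable (fun r : ℝ => G (U (2 + t₀ + u + r.toNNReal) ω)) (volume.restrict (Ioc (0 : ℝ) T)) :=
        FeynmanKac.integrable_of_measurable_of_abs_le _ (hG.comp (hsec ω)) fun r => hG1 _
      have i2 : Integrable (fun r : ℝ => g j (U (2 + t₀ + u + r.toNNReal) ω)) (volume.restrict (Ioc (0 : ℝ) T)) :=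
        FeynmanKac.integrable_of_measurable_of_abs_le _ ((hgm j).comp (hsec ω)) fun r => hg1 j _
      rw [integral_sub i1 i2]
      ring
    have hpt : ∀ ω, |Y ω - Yg j ω| ≤
        |∫ r in Ioc 0 T, (G (U (2 + t₀ + u + r.toNNReal) ω) - g j (U (2 + t₀ + u + r.toNNReal) ω))| + T * δ j := fun ω => by
      rw [hsplit ω]
      refine (abs_sub _ _).trans (add_le_add le_rfl ?_)
      rw [abs_mul, abs_of_pos hT]; exact mul_le_mul_of_nonneg_left (hmm j) hT.le
    have hF := coldStart_integral_abs_timeIntegral_le_uniform L β' hβ z hW hU0 hU hUj (hdiff j) (hdiffb j) t₀ u ht₀ hT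
    calc ∫ ω, |Y ω - Yg j ω| ∂P
        ≤ ∫ ω, (|∫ r in Ioc 0 T, (G (U (2 + t₀ + u + r.toNNReal) ω) - g j (U (2 + t₀ + u + r.toNNReal) ω))| + T * δ j) ∂P :=
          integral_mono (FeynmanKac.integrable_of_measurable_of_abs_le _ (hYm.sub (hYgm j)).abs (B := 2 * T + 2 * T) fun ω => by
            rw [abs_abs]; exact (abs_sub _ _).trans (add_le_add (hYb ω) (hYgb j ω))) (hDi.add (integrable_const _)) hpt
      _ = (∫ ω, |∫ r in Ioc 0 T, (G (U (2 + t₀ + u + r.toNNReal) ω) - g j (U (2 + t₀ + u + r.toNNReal) ω))| ∂P) + T * δ j := by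
          rw [integral_add hDi (integrable_const _), integral_const, probReal_univ, one_smul]
      _ ≤ T * (Real.exp 1 * Real.sqrt (2 * δ j)) + T * δ j :=
          add_le_add (hF.trans (mul_le_mul_of_nonneg_left (mul_le_mul_of_nonneg_left (hL2 j) (Real.exp_pos 1).le) hT.le)) le_rfl
      _ = T * (Real.exp 1 * Real.sqrt (2 * δ j) + δ j) := by ring
  -- the continuous case for each `g j` (`b = 2`, `σ_j² = σ² + 4δ_j`)
  have hcont : ∀ j, Integrable (fun ω => Real.exp (θ * Yg j ω)) P ∧
      ∫ ω, Real.exp (θ * Yg j ω) ∂P ≤ Real.exp 1 * Real.exp (T * (θ ^ 2 * (σ ^ 2 + 4 * δ j) / (lam - θ * 2))) := by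
    intro j
    have hGb : ∀ x, |g j x - ∫ y, g j y ∂(wilsonMeasure (d := 3) (L := L) (fundamentalRep (Fin 2)) β')| ≤ 2 := fun x =>
      (abs_sub _ _).trans (by linarith [hg1 j x, (abs_integral_le_of_abs_le_of_isProbabilityMeasure (hg1 j) : |∫ y, g j y ∂(wilsonMeasure (d := 3) (L := L) (fundamentalRep (Fin 2)) β')| ≤ 1)])
    have hsj : 0 < Real.sqrt (σ ^ 2 + 4 * δ j) := Real.sqrt_pos.2 (by nlinarith [hδ0 j])
    have h := coldStart_integral_exp_timeIntegral_le_uniform L β' hβ z hW hU0 hU (hgc j) (b := 2) (by norm_num) hGb hsj (hvar j) hθ hθ2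
      t₀ u ht₀ hT
    rw [Real.sq_sqrt (by nlinarith [hδ0 j])] at h
    exact h
  -- integrability of `exp(θY)` and the difference of the exponential moments
  have hexpYi : Integrable (fun ω => Real.exp (θ * Y ω)) P :=
    FeynmanKac.integrable_of_measurable_of_abs_le _ (Real.measurable_exp.comp (hYm.const_mul θ)) (B := Real.exp (θ * (2 * T))) fun ω => by
      rw [abs_of_pos (Real.exp_pos _)]; exact Real.exp_le_exp.2 (mul_le_mul_of_nonneg_left ((le_abs_self _).trans (hYb ω)) hθ)
  have hkey : ∀ j, ∫ ω, Real.exp (θ * Y ω) ∂P ≤ Real.exp 1 * Real.exp (T * (θ ^ 2 * (σ ^ 2 + 4 * δ j) / (lam - θ * 2))) +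
      θ * Real.exp (θ * (2 * T)) * (T * (Real.exp 1 * Real.sqrt (2 * δ j) + δ j)) := by
    intro j
    have hdiffI : |(∫ ω, Real.exp (θ * Y ω) ∂P) - ∫ ω, Real.exp (θ * Yg j ω) ∂P| ≤
        θ * Real.exp (θ * (2 * T)) * (T * (Real.exp 1 * Real.sqrt (2 * δ j) + δ j)) := by
      rw [← integral_sub hexpYi (hcont j).1]
      have hpt : ∀ ω, |Real.exp (θ * Y ω) - Real.exp (θ * Yg j ω)| ≤ θ * Real.exp (θ * (2 * T)) * |Y ω - Yg j ω| := fun ω => by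
        have h := EquipartitionPinsProbe.TangentSteinFiniteBeta.abs_exp_sub_exp_le (M := θ * (2 * T))
          (mul_le_mul_of_nonneg_left ((le_abs_self _).trans (hYb ω)) hθ) (mul_le_mul_of_nonneg_left ((le_abs_self _).trans (hYgb j ω)) hθ)
        rw [← mul_sub, abs_mul, abs_of_nonneg hθ] at h
        linarith [h]
      calc |∫ ω, (Real.exp (θ * Y ω) - Real.exp (θ * Yg j ω)) ∂P| ≤ ∫ ω, |Real.exp (θ * Y ω) - Real.exp (θ * Yg j ω)| ∂P :=
            abs_integral_le_integral_abs
        _ ≤ ∫ ω, θ * Real.exp (θ * (2 * T)) * |Y ω - Yg j ω| ∂P :=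
            integral_mono_of_nonneg (ae_of_all _ fun ω => abs_nonneg _)
              ((FeynmanKac.integrable_of_measurable_of_abs_le _ (hYm.sub (hYgm j)).abs (B := 2 * T + 2 * T) fun ω => by
                rw [abs_abs]; exact (abs_sub _ _).trans (add_le_add (hYb ω) (hYgb j ω))).const_mul _) (ae_of_all _ hpt)
        _ = θ * Real.exp (θ * (2 * T)) * ∫ ω, |Y ω - Yg j ω| ∂P := integral_const_mul _ _
        _ ≤ θ * Real.exp (θ * (2 * T)) * (T * (Real.exp 1 * Real.sqrt (2 * δ j) + δ j)) :=
            mul_le_mul_of_nonneg_left (hEdiff j) (by positivity)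
    linarith [(abs_le.1 hdiffI).2, (hcont j).2]
  have hlim : Tendsto (fun j => Real.exp 1 * Real.exp (T * (θ ^ 2 * (σ ^ 2 + 4 * δ j) / (lam - θ * 2))) +
      θ * Real.exp (θ * (2 * T)) * (T * (Real.exp 1 * Real.sqrt (2 * δ j) + δ j))) atTop
      (𝓝 (Real.exp 1 * Real.exp (T * (θ ^ 2 * (σ ^ 2 + 4 * 0) / (lam - θ * 2))) +
        θ * Real.exp (θ * (2 * T)) * (T * (Real.exp 1 * Real.sqrt (2 * 0) + 0)))) :=
    (tendsto_const_nhds.mul ((Real.continuous_exp.tendsto _).comp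
      ((((tendsto_const_nhds.add (hδlim.const_mul 4)).const_mul (θ ^ 2)).div_const (lam - θ * 2)).const_mul T))).add
      (tendsto_const_nhds.mul (((tendsto_const_nhds.mul ((Real.continuous_sqrt.tendsto _).comp (hδlim.const_mul 2))).add hδlim).const_mul T))
  simp only [mul_zero, add_zero, Real.sqrt_zero] at hlim
  exact ⟨hexpYi, ge_of_tendsto' hlim hkey⟩

end Summit.QuantumFields.YangMills.Theorems.ColdStartUniversality

end
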